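import Summits.QuantumFields.YangMills.Theorems.BalabanUVNodesN22AtRecordOfKernelFadingAgeWeighted
import Summits.QuantumFields.YangMills.Theorems.BalabanUVNodesN22AtRecordOfKernelFadingRealSmoothPrinted

/-!
# NODE N22 (NE9) — ONE MORE PRINT-LEVEL SUBSTITUTION ON THE SECTOR ∕ REAL-SMOOTH EDITIONS OF K3's `h9`, AT A GENERAL AGE-GROWTH RATIO `q ≥ 1` (dag-n22-c g16's J49; `q = 1` is J46):
# the printed-type OUTPUT bound (1.18) of J46∕J49 §2∕§3 is NOT an independent input — along the READING it follows from PRINTED (2.38) by the cluster expansion ([II] (2.39)–(2.41)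
# p. 21).  K3's `h9` WITH THE RECORD's GEOMETRIC MODULI from node N18's kernel step rate + SECTOR holomorphy (resp. REAL `C^{1,1}` dependence) in each young coupling with constants
# growing like `q^{k−i}` in the age + PRINTED (2.38) + PRINTED `AnalyticH` + holomorphic readings + p. 282 tails + W1-20's law + (1.21) ∕ (G≈) — NO (1.18) bound, NO term-holomorphy
# binder displayed

Cell `pub-ymgap`, Track A (HUMAN RULING D-0062), WIDTH SEAT `dag-n22-w5` (g2, harness re-seat of base w5) on node n22 = NE9, D-0154 (3a) second width wave;
`--kind proof --supports stmt-QuantumFields-27366 --as helper` (KEY MAP v2: K3⁸ `SpineGivenEndpointR13SepCoPHV`, skeleton v6 b4e55110ab73e679, §2b socket `h9` = K3⁷ v5's verbatim),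
COUNT-NEUTRAL; THEOREMS ONLY (0 `def`, 0 `sorry`, standard axioms).  CLAIM-4 on the bus (self-located, own lineage; RE-SCOPED onto J49 — dag-n22-c g16's WORD (a), pub-ymgap INBOX
2026-08-28T14:53Z: «print-level twins of J49 … yours»).
CONTEXT.  dag-n22-c g16's J48∕J49 (`…N22KernelFadingAgeWeighted` ∕ `…N22AtRecordOfKernelFadingAgeWeighted`) re-keyed the kernel-fading road at a general AGE-GROWTH RATIO `q ≥ 1` of
the young-coupling constants (row `ℓ.θ₅·q ≤ ℓ.ω²`; J38∕J45∕J46 and this lineage's p639775∕p641315 pinned `q = 1`, i.e. asked age-UNIFORM constants, which the in-tree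
recursion-level producer shape does not deliver outside ROAD 1's clause).  J46 (`…N22AtRecordOfKernelFadingSector`, dag-n22-c g15) §2 `…_termSecondDiff_outputBound` and §3 `…_sectorHolo`, and their print-level editions in this lineage (p639775
`…KernelFadingSectorPrinted`, p641315 `…KernelFadingRealSmoothPrinted`), display the printed-type OUTPUT bound `hbd : ‖E^{(k+1)}(X; g; φ)‖ ≤ B·e^{−κ_E d_{k+1}(X)}` on the space tables
([I] (1.18)).  In print (1.18) at the new level is a CONSEQUENCE of Lemma 3's (2.38) through the convergent cluster expansion ((2.39)–(2.41)); the tree has that step as dag-n22-c's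
J30 v1.1 `differentiableOn_and_norm_clusterStepE_comp_le_of_activityHol` (S25's parametric Kotecký–Preiss engine at the activity family read through a holomorphic chart): for
`Bound238 (box γ k) sp A R` + Road 1's numerals + activities holomorphic through the reading `Φ` on open `U` mapping `U` into the space of every sub-polymer, the (2.13) term is
holomorphic on `U` AND `‖E^{(k+1)}(X; hist; Φ z)‖ ≤ e·9·64·K₀(64,8)²·A·e^{−r₁ d_{k+1}(X)}` for `z ∈ U`.  The table-level twin (node N18's `N18HLayerW1Config.analyticOnNhd_and_bound_E_of_bound238_four`)
needs OPEN tables with the restriction property, and `…N18HLayerW1SpaceNotOpen` records that the space tables of record are NOT open — so THIS FILE makes the substitution along the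
reading, at the general ratio `q`: J49 §2∕§3 (`…_termSecondDiffGrowing_outputBound` ∕ `…_sectorHoloGrowing`) are run at the READING's IMAGE tables `X ↦ Φ K k X '' U K k X`, on which `hbd` is §0 below, the sector ∕ `C^{1,1}` datum restricts from the original tables
by the space clause at `Z = X`, `hEhol` is p621851 §0 and the ball clause is `ball 0 r ⊆ U`.  One application each; nothing of J30 ∕ J32′ ∕ J45 ∕ J46 ∕ J48 ∕ J49 ∕ p621851 ∕
p616912 ∕ p639775 ∕ p641315 is re-declared; `q = 1` recovers the J46-based statements on the nose.

WHAT.  §0 ★ `outputBound_readingImage_of_printedSlots` — PRINTED (2.38) + numerals + PRINTED `AnalyticH` + holomorphic readings with dag-n22-w3's sub-polymer clause on `U` +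
`κ_E ≤ r₁` ⟹ the (1.18)-type bound ON THE IMAGE TABLES with `B := e·9·64·K₀(64,8)²·A`, rate `κ_E`, every window history (J30 v1.1 ∘ J32′ §1).
§1 ★★★ `ne9_EA_objectsOfRecord₁₃_of_kernelStepRate_sectorHoloGrowing_printedValue` (+ `_twoPointGenerating` twin) — `NE9 ((objectsOfRecord₁₃ F N θ ℓ).EA 0) (Window θ.γ) ℓ.κ ℓ.moduli`
from: `ℓ.Signs`, `0 < θ.γ`; node N18's `KernelStepRateOfRecord₁₃ F N θ κ₅ ℓ.θ₅ C₅`; W1-20's law; THE SECTOR DATUM `hLsec` (aperture `c > 0` — read at `c < 1` for «no disc through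
`g = 0`», ref-Q READ-102 P1 — centred quadratic bound `B″·q^{k−i}·e^{−κ_E d}·s²`, `q ≥ 1`) on general tables `sp`; PRINTED `Bound238 (box θ.γ k) (sp K k) A R` and PRINTED `AnalyticH (box θ.γ k) (sp K k)` with Road 1's
numerals; `2κ₀(64,8) ≤ κ ≤ κ_E ≤ r₁`; holomorphic complexified probe readings on `U K k X ⊇ ball 0 r` (chart clause, sub-polymer space clause on `U`); site weights with tails;
`PolLimitsExistOfRecord₁₃ F N θ` (twin: the small∕near class `lo`, the bidisc radius, (G≈), numerals `0 < κ`, `κ₀(64,8) ≤ κ∕4` instead); rows `ℓ.θ₅·q ≤ ℓ.ω²`, … with `B := e·9·64·K₀(64,8)²·A`,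
`M₂ := (6c²+32c+64)∕c²·B″`.
§2 ★★★ `ne9_EA_objectsOfRecord₁₃_of_kernelStepRate_derivLipschitzGrowing_printedValue` (+ twin) — the same with the REAL `C^{1,1}` datum `hC11` (letter `L ≥ 0`; p641315 §0
`norm_secondDiff_le_of_derivLipschitz`) in place of the sector datum (J46 §2 at the image tables, `M₂ := L`).
NO (1.18) output bound, NO term-holomorphy binder (and in the twins NO (1.21) letter) is displayed.  Pin faces omitted: one line each by dag-n22-w3's
`n22At_rateCarriers_of_kernels_pin_of_ne9` (as in p639775 ∕ p641315).
THE N22 ROW SENTENCE, print-level: «N18's kernel step rate + SECTOR holomorphy (resp. real `C^{1,1}`) of the (2.13) terms in each young coupling with `q^{age}`-growing constants + printed (2.38) + printed configuration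
analyticity + holomorphic minimizer readings + p. 282 tails + W1-20's law + (1.21) [resp. (G≈)] + letter rows ⇒ K3's `h9` with the record's GEOMETRIC moduli» — (1.18) DERIVED.

HONEST FRAMING (binding).  Count-neutral COMPOSITION of landed theorems by name; removes ONE displayed input by deriving it from PRINTED (2.38) along the reading; NO estimate of
Bałaban's is proved or asserted AT THE RECORD: the (2.38) slot and `AnalyticH` (N10 ∕ NODE A at the towers of record), the readings + tails (NODE A ∕ N09), the sector ∕ `C^{1,1}` data
(the cell's QUANTITATIVE readings of [I] p. 263 ∕ (2.12)–(2.13) p. 268 — NOT printed displays; NODE A ∕ N09 ∕ N10 ∕ def-W1), N18's kernel step rate (node N18 — NE5 NOT PRINTED for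
d = 4), the law (NODE A ∕ N10 ∕ def-W1), (G≈) (NODE A ∕ def-W1, not typed here) and (1.21) (dag-n22-w3's road — REDUCED in the twins, not proved) stay DISPLAYED with their owners;
nothing of the record is constructed or claimed to meet them; N22 is NOT discharged (typed 28∕28 · discharged 5∕27 UNCHANGED); K3⁸ OPEN and NOT claimed (no stub of 27366 is touched);
NE9 is NOT IN PRINT for d = 4; no count claim (the chair's single count line is the only count); no summit statement is proved by this seat; one finite 𝕋⁴ programme at fixed ε — R4
closes the CONDITIONAL rung `BalabanLadder.UV` only; NOTHING about the continuum limit, ℝ⁴, infinite volume, OS axioms, a mass gap or the Clay problem is proved or claimed by any of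
this.  A5∕A6: as in p639775 ∕ p641315 (letter rows jointly satisfiable with `ℓ.Signs`, J42 §2; non-degenerate kernel-fading model p627338; sector witness J47; (G≈) letter fires at the
empty towers, p616912 §4 — DEGENERATE, declared); the filing is LOCATED, not a discharge.  References (TYPES only, no cite tags on the Summit side): [I] = Bałaban, CMP 109 (1987) Thm 1
p. 259, (1.7) p. 261, §1 p. 263 with (1.18), (1.20)–(1.21) p. 264, §2 p. 266, (2.12)–(2.13) p. 268, p. 282, (5.10) p. 293; [II] = CMP 116 (1988) (2.13)–(2.14) pp. 14–15, p. 15,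
Lemma 3 (2.38) p. 20, (2.39)–(2.41) p. 21; King, CMP 102 (1986) Lemma 4.5; [Chae1985] Ch. 15.
-/

noncomputable section

open Filter Topology Metric Set
open scoped BigOperators

namespace YMDAG.N22.AtRecordOfPrintedSlots

open Literature.MathematicalPhysics.QuantumFieldTheory.Balaban1983to89
open Literature.MathematicalPhysics.QuantumFieldTheory.Balaban1983to89.T4Continuum (T4Family ULoop)
open Literature.MathematicalPhysics.QuantumFieldTheory.Balaban1983to89.T4OutputRate (Window NE9)
open Literature.MathematicalPhysics.QuantumFieldTheory.Balaban1983to89.B12TreeDecay (K₀ kappa₀)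
open Literature.MathematicalPhysics.QuantumFieldTheory.Balaban1983to89.B12Decay510 (delta1)
open Literature.MathematicalPhysics.QuantumFieldTheory.Balaban1983to89.B12Decay510Window (K₁)
open Literature.MathematicalPhysics.QuantumFieldTheory.Balaban1983to89.B12Decay510Torus (distCT nearT)
open Literature.MathematicalPhysics.QuantumFieldTheory.Balaban1983to89.TreeLengthTorus (TPt torusTreeLen torusTreeLen_nonneg)
open Literature.MathematicalPhysics.QuantumFieldTheory.Balaban1983to89.Node00 (siteOfInt Stage13Params Stage13HParams U3Letters₁₁ MatA)
open Literature.MathematicalPhysics.QuantumFieldTheory.Balaban1983to89.Node00.Sect2 (domCount domSys CPair)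
open Literature.MathematicalPhysics.QuantumFieldTheory.Balaban1983to89.Node00.LocalizedSum17 (ReadingMaps Localizes17OfRecord₁₃)
open Literature.MathematicalPhysics.QuantumFieldTheory.Balaban1983to89.Node00.W1 (ClusterTower ClusterStep box)
open Literature.MathematicalPhysics.QuantumFieldTheory.Balaban1983to89.Node00.U3OfKernels (histPrefix objectsOfRecord₁₃)
open Literature.MathematicalPhysics.QuantumFieldTheory.Balaban1983to89.Node00.U3KernelLetters (KernelStepRateOfRecord₁₃ PolLimitsExistOfRecord₁₃)
open YMDAG.N22.WindowedOfCouplingHolo (differentiableOn_H_comp_of_analyticH histPrefix_mem_box)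
open YMDAG.N22.WindowOfLocalTerms (differentiableOn_and_norm_clusterStepE_comp_le_of_activityHol)
open YMDAG.N22.AtKernels (polLimitsExistOfRecord₁₃_of_twoPointGenerating)
open YMDAG.N22.KernelFading (ne9_EA_objectsOfRecord₁₃_of_kernelStepRate_termSecondDiffGrowing_outputBound
  ne9_EA_objectsOfRecord₁₃_of_kernelStepRate_sectorHoloGrowing)

open scoped Matrix.Norms.L2Operator

variable (F : T4Family)

/-! ## §0 (1.18) ALONG THE READING FROM PRINTED (2.38): the cluster expansion's value bound (J30 v1.1 ∘ J32′ §1) -/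

/-- ★ **THE OUTPUT BOUND ON THE READING's IMAGE TABLES FROM PRINT's SLOTS.**  For towers `S`, window `]0, γ]^ℕ`, space tables `sp`: PRINTED (2.38) `Bound238 (box γ k) (sp K k) A R`
+ Road 1's numerals + PRINTED `AnalyticH` + holomorphic readings `Φ K k X` on open `U K k X` mapping `U` into `sp K k Z` for every `Z ⊆ X` + `κ_E ≤ r₁` ⟹ for every window
history `g`, every `(K, k, X)` and every `φ = Φ K k X z`, `z ∈ U K k X`: `‖E^{(k+1)}(X; histPrefix g k; φ)‖ ≤ e·9·64·K₀(64,8)²·A·e^{−κ_E d_{k+1}(X)}` — the VALUE half of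
dag-n22-c's `differentiableOn_and_norm_clusterStepE_comp_le_of_activityHol` ([II] (2.39)–(2.41)) at the activity family made holomorphic by `differentiableOn_H_comp_of_analyticH`, rate
weakened along `d_{k+1}(X) ≥ 0`.  (1.18) at the new level as a CONSEQUENCE of (2.38), as in print. -/
theorem outputBound_readingImage_of_printedSlots {𝔸 : Type*} [NormedRing 𝔸] [NormedAlgebra ℂ 𝔸] {M : ℕ}
    (S : (K : ℕ) → ClusterTower (F.P K) 𝔸 M) {γ : ℝ} (sp : (K k : ℕ) → (domSys (F.P K) M (k + 1)).Dom → Set (CPair (F.P K) 𝔸)) {A R r₁ κE : ℝ}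
    (hA : 0 ≤ A) (hr₁ : 0 ≤ r₁) (hrate : r₁ + 2 * (64 * Real.log 162) + 2 ≤ R) (hsmall : A * Real.exp (5 * r₁ + 1) * K₀ 64 8 * 9 * 64 ≤ 1) (hκEr : κE ≤ r₁)
    (h238 : ∀ K k, ((S K) k).Bound238 (box γ k) (sp K k) A R) (hAn : ∀ K k, ((S K) k).AnalyticH (box γ k) (sp K k))
    (Ec : ℕ → ℕ → Type*) [∀ K k, NormedAddCommGroup (Ec K k)] [∀ K k, NormedSpace ℂ (Ec K k)]
    (Φ : (K k : ℕ) → (domSys (F.P K) M (k + 1)).Dom → Ec K k → CPair (F.P K) 𝔸)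
    (U : (K k : ℕ) → (domSys (F.P K) M (k + 1)).Dom → Set (Ec K k)) (hU : ∀ K k X, IsOpen (U K k X))
    (hΦhol : ∀ (K k : ℕ) (X : (domSys (F.P K) M (k + 1)).Dom), DifferentiableOn ℂ (Φ K k X) (U K k X))
    (hΦsp : ∀ (K k : ℕ) (X : (domSys (F.P K) M (k + 1)).Dom), ∀ z ∈ U K k X, ∀ Z : (domSys (F.P K) M (k + 1)).Dom, Z.1 ⊆ X.1 → Φ K k X z ∈ sp K k Z) :
    ∀ g ∈ Window γ, ∀ (K k : ℕ) (X : (domSys (F.P K) M (k + 1)).Dom), ∀ φ ∈ Φ K k X '' U K k X,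
      ‖((S K) k).E (histPrefix g k) φ X‖ ≤ Real.exp 1 * 9 * 64 * K₀ 64 8 ^ 2 * A * Real.exp (-(κE * (domSys (F.P K) M (k + 1)).dj X)) := by
  intro g hg K k X φ hφ
  obtain ⟨z, hz, rfl⟩ := hφ
  have h := (differentiableOn_and_norm_clusterStepE_comp_le_of_activityHol F K ((S K) k) (box γ k) (sp K k) hA hr₁ hrate hsmall (h238 K k)
    (histPrefix_mem_box hg k) X (Φ K k X) (hU K k X)
    (differentiableOn_H_comp_of_analyticH ((S K) k) (box γ k) (sp K k) (hAn K k) (histPrefix_mem_box hg k) (Φ K k X) (hΦhol K k X) X (hΦsp K k X))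
    (hΦsp K k X)).2 z hz
  have hd : 0 ≤ torusTreeLen X.1 := torusTreeLen_nonneg _
  have hexp : Real.exp (-(r₁ * torusTreeLen X.1)) ≤ Real.exp (-(κE * (domSys (F.P K) M (k + 1)).dj X)) :=
    Real.exp_le_exp.2 (by show -(r₁ * torusTreeLen X.1) ≤ -(κE * torusTreeLen X.1); nlinarith)
  exact h.trans (mul_le_mul_of_nonneg_left hexp (by positivity))

variable (N : ℕ) [NeZero N]

/-! ## §1 The SECTOR edition at the reading's image tables: (1.18) and term holomorphy both from print's slots -/

open Classical in
/-- ★★★ **K3's `h9` — AGE-WEIGHTED SECTOR EDITION WITH (1.18) DERIVED.**  J49 §3 `ne9_EA_objectsOfRecord₁₃_of_kernelStepRate_sectorHoloGrowing` at the image tables `X ↦ Φ K k X '' U K k X`: the sector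
datum `hLsec` on the ORIGINAL tables restricts there (space clause at `Z = X`), `hbd` := §0, `hEhol` := p621851 §0, ball clause := `ball 0 r ⊆ U`.  Inputs: `ℓ.Signs`, `0 < θ.γ`, node N18's
`KernelStepRateOfRecord₁₃ F N θ κ₅ ℓ.θ₅ C₅`, law, `hLsec` (`c > 0`, `B″ ≥ 0`, growth `q ≥ 1`, rate `κ_E`), PRINTED `Bound238` ∕ `AnalyticH` on the boxes with numerals, `2κ₀(64,8) ≤ κ ≤ κ_E ≤ r₁`, holomorphic
readings (chart clause, sub-polymer clause on `U ⊇ ball 0 r`), tails, `PolLimitsExistOfRecord₁₃ F N θ`, rows (`ℓ.θ₅·q ≤ ℓ.ω²`) with `B := e·9·64·K₀(64,8)²·A` ⟹ `NE9 ((objectsOfRecord₁₃ F N θ ℓ).EA 0)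
(Window θ.γ) ℓ.κ ℓ.moduli`.  NO (1.18) bound, NO term-holomorphy binder displayed.  LOCATED (hypothesis form); N22 NOT discharged. -/
theorem ne9_EA_objectsOfRecord₁₃_of_kernelStepRate_sectorHoloGrowing_printedValue (θ : Stage13Params F N) (ℓ : U3Letters₁₁) (hs : ℓ.Signs) (hγ : 0 < θ.γ)
    (hlim : PolLimitsExistOfRecord₁₃ F N θ) {κ₅ C₅ : ℝ} (hC₅ : 0 ≤ C₅) (h5 : KernelStepRateOfRecord₁₃ F N θ κ₅ ℓ.θ₅ C₅)
    {𝔸 : Type*} [NormedRing 𝔸] [NormedAlgebra ℂ 𝔸] (m' : ℕ) (M : ℕ) [NeZero M] (hM : M = F.L ^ m')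
    (S : (K : ℕ) → ClusterTower (F.P K) 𝔸 M) (emb : ReadingMaps F (MatA N) 𝔸) (hloc : Localizes17OfRecord₁₃ F N θ S emb)
    (sp : (K k : ℕ) → (domSys (F.P K) M (k + 1)).Dom → Set (CPair (F.P K) 𝔸))
    {κ κE δ₀ B₃ r c B'' q A R r₁ : ℝ} (hc : 0 < c) (hB'' : 0 ≤ B'') (hq : 1 ≤ q)
    (hA : 0 ≤ A) (hr₁ : 0 ≤ r₁) (hrate : r₁ + 2 * (64 * Real.log 162) + 2 ≤ R) (hsmall : A * Real.exp (5 * r₁ + 1) * K₀ 64 8 * 9 * 64 ≤ 1)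
    (hκ₀ : kappa₀ (4 * 2 ^ 4) (2 * 4) ≤ κ / 2) (hδ₀ : 0 < δ₀) (hB₃ : 0 ≤ B₃) (hr : 0 < r) (hκE : κ ≤ κE) (hκEr : κE ≤ r₁)
    (hLsec : ∀ (K k : ℕ) (i : Fin (k + 1)), ∀ g ∈ box θ.γ k, ∀ (X : (domSys (F.P K) M (k + 1)).Dom), ∀ φ ∈ sp K k X,
      ∃ (Ec : ℂ → ℂ) (O : Set ℂ) (Vc : ℂ), DifferentiableOn ℂ Ec O ∧ (∀ s ∈ Ioc (0 : ℝ) θ.γ, closedBall (s : ℂ) (c * s) ⊆ O) ∧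
        (∀ s ∈ Ioc (0 : ℝ) θ.γ, ∀ z ∈ closedBall (s : ℂ) (c * s), ‖Ec z - Vc‖ ≤ B'' * q ^ (k - (i : ℕ)) * Real.exp (-(κE * (domSys (F.P K) M (k + 1)).dj X)) * s ^ 2) ∧
        (∀ t ∈ Ioc (0 : ℝ) θ.γ, Ec t = ((S K) k).E (Function.update g i t) φ X))
    (h238 : ∀ K k, ((S K) k).Bound238 (box θ.γ k) (sp K k) A R) (hAn : ∀ K k, ((S K) k).AnalyticH (box θ.γ k) (sp K k))
    (Ec : ℕ → ℕ → Type*) [∀ K k, NormedAddCommGroup (Ec K k)] [∀ K k, NormedSpace ℂ (Ec K k)]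
    (ι : letI := θ.instVβ₁; letI := θ.instVβ₂
      (K k : ℕ) → (domSys (F.P K) M (k + 1)).Dom → ((Fin (F.P K).d → Site (F.P K) (k + 1) → θ.Vβ) →L[ℝ] Ec K k))
    (Φ : (K k : ℕ) → (domSys (F.P K) M (k + 1)).Dom → Ec K k → CPair (F.P K) 𝔸)
    (U : (K k : ℕ) → (domSys (F.P K) M (k + 1)).Dom → Set (Ec K k)) (hU : ∀ K k X, IsOpen (U K k X)) (hrU : ∀ K k X, ball (0 : Ec K k) r ⊆ U K k X)
    (hΦhol : ∀ (K k : ℕ) (X : (domSys (F.P K) M (k + 1)).Dom), DifferentiableOn ℂ (Φ K k X) (U K k X))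
    (hΦemb : letI := θ.instVβ₁; letI := θ.instVβ₂
      ∀ (K k : ℕ) (X : (domSys (F.P K) M (k + 1)).Dom) (Bf : Fin (F.P K).d → Site (F.P K) (k + 1) → θ.Vβ),
        Φ K k X (ι K k X Bf) = emb K k (fun l t => NormedSpace.exp (θ.ρ8 (Bf l t))))
    (hΦsp : ∀ (K k : ℕ) (X : (domSys (F.P K) M (k + 1)).Dom), ∀ z ∈ U K k X, ∀ Z : (domSys (F.P K) M (k + 1)).Dom, Z.1 ⊆ X.1 → Φ K k X z ∈ sp K k Z)
    (w : (K k : ℕ) → (domSys (F.P K) M (k + 1)).Dom → Site (F.P K) (k + 1) → ℝ) (hw₀ : ∀ K k X t, 0 ≤ w K k X t)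
    (hw : letI := θ.instVβ₁; letI := θ.instVβ₂; letI := θ.instιβ
      ∀ (K k : ℕ) (X : (domSys (F.P K) M (k + 1)).Dom) (l : Fin (F.P K).d) (t : Site (F.P K) (k + 1)) (cc : θ.ιβ),
        ‖ι K k X (Pi.single l (Pi.single t (θ.bV cc)))‖ ≤ w K k X t)
    (htail : ∀ (K k : ℕ) (X : (domSys (F.P K) M (k + 1)).Dom) (t : Site (F.P K) (k + 1)),
      let e : Site (F.P K) (k + 1) → TPt 4 (domCount (F.P K) M (k + 1) * M) := fun x i => (ZMod.cast (x i) : ZMod (domCount (F.P K) M (k + 1) * M))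
      w K k X t ≤ B₃ * Real.exp (-δ₀ * distCT (domCount (F.P K) M (k + 1)) M (e t) (nearT (M := M) (e t) X)))
    (hκ₅ : delta1 δ₀ κ ((M : ℝ) * 4) ≤ κ₅) (hω : 0 < ℓ.ω) (hθω : ℓ.θ₅ * q ≤ ℓ.ω ^ 2) (hℓκ : ℓ.κ ≤ delta1 δ₀ κ ((M : ℝ) * 4))
    (hC₉ : (4 * (2 * C₅ / (1 - ℓ.θ₅) + 2 * ((16 * (Real.exp 1 * 9 * 64 * K₀ 64 8 ^ 2 * A) * B₃ ^ 2 / r ^ 2) * Real.exp (delta1 δ₀ κ ((M : ℝ) * 4) * ((M : ℝ) * 4) * 3) *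
        K₀ (4 * 2 ^ 4) (2 * 4) * K₁ 4 (δ₀ / 2))) / θ.γ +
        ((16 * ((6 * c ^ 2 + 32 * c + 64) / c ^ 2 * B'') * B₃ ^ 2 / r ^ 2) * Real.exp (delta1 δ₀ κ ((M : ℝ) * 4) * ((M : ℝ) * 4) * 3) * K₀ (4 * 2 ^ 4) (2 * 4) *
          K₁ 4 (δ₀ / 2)) * θ.γ / 2) / ℓ.ω ≤ ℓ.C₉) :
    NE9 ((objectsOfRecord₁₃ F N θ ℓ).EA 0) (Window θ.γ) ℓ.κ ℓ.moduli :=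
  ne9_EA_objectsOfRecord₁₃_of_kernelStepRate_sectorHoloGrowing F N θ ℓ hs hγ hlim hC₅ h5 m' M hM S emb hloc (fun K k X => Φ K k X '' U K k X) hc hB'' hq hκ₀ hδ₀ hB₃ hr
    (by positivity) hκE
    (fun K k i g hg X φ hφ => by
      obtain ⟨z, hz, rfl⟩ := hφ
      exact hLsec K k i g hg X _ (hΦsp K k X z hz X subset_rfl))
    (outputBound_readingImage_of_printedSlots F S sp hA hr₁ hrate hsmall hκEr h238 hAn Ec Φ U hU hΦhol hΦsp)
    Ec ι Φ U hU hrU (differentiableOn_E_comp_of_printedSlots F S sp hA hr₁ hrate hsmall h238 hAn Ec Φ U hU hΦhol hΦsp) hΦemb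
    (fun K k X z hz => mem_image_of_mem _ (hrU K k X hz)) w hw₀ hw htail hκ₅ hω hθω hℓκ hC₉

open Classical in
/-- ★★★ **K3's `h9` — AGE-WEIGHTED SECTOR EDITION WITH (1.18) DERIVED AND (1.21) BY (G≈).**  §1 with `hlim := polLimitsExistOfRecord₁₃_of_twoPointGenerating …` (p616912 §3 on the ORIGINAL tables;
numerals `0 < κ`, `κ₀(64,8) ≤ κ∕4`, `κ ≤ r₁` from `κ ≤ κ_E ≤ r₁`): … + the small∕near class `lo` + the bidisc radius `0 < r₂`, `(2B₃+1) r₂ ≤ r` + (G≈) at rate `0 ≤ r₀ < 1`.  NO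
(1.18) bound, NO term-holomorphy binder, NO (1.21) letter displayed.  LOCATED (hypothesis form); N22 NOT discharged. -/
theorem ne9_EA_objectsOfRecord₁₃_of_kernelStepRate_sectorHoloGrowing_printedValue_twoPointGenerating (θ : Stage13Params F N) (ℓ : U3Letters₁₁) (hs : ℓ.Signs)
    (hγ : 0 < θ.γ) {κ₅ C₅ : ℝ} (hC₅ : 0 ≤ C₅) (h5 : KernelStepRateOfRecord₁₃ F N θ κ₅ ℓ.θ₅ C₅)
    {𝔸 : Type*} [NormedRing 𝔸] [NormedAlgebra ℂ 𝔸] (m' : ℕ) (M : ℕ) [NeZero M] (hM : M = F.L ^ m')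
    (S : (K : ℕ) → ClusterTower (F.P K) 𝔸 M) (emb : ReadingMaps F (MatA N) 𝔸) (hloc : Localizes17OfRecord₁₃ F N θ S emb)
    (sp : (K k : ℕ) → (domSys (F.P K) M (k + 1)).Dom → Set (CPair (F.P K) 𝔸))
    {κ κE δ₀ B₃ r c B'' q A R r₁ r₂ r₀ : ℝ} (hc : 0 < c) (hB'' : 0 ≤ B'') (hq : 1 ≤ q)
    (hA : 0 ≤ A) (hr₁ : 0 ≤ r₁) (hrate : r₁ + 2 * (64 * Real.log 162) + 2 ≤ R) (hsmall : A * Real.exp (5 * r₁ + 1) * K₀ 64 8 * 9 * 64 ≤ 1)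
    (hκ0 : 0 < κ) (hκ4 : kappa₀ (4 * 2 ^ 4) (2 * 4) ≤ κ / 2 / 2) (hδ₀ : 0 < δ₀) (hB₃ : 0 ≤ B₃) (hr : 0 < r) (hκE : κ ≤ κE) (hκEr : κE ≤ r₁)
    (hLsec : ∀ (K k : ℕ) (i : Fin (k + 1)), ∀ g ∈ box θ.γ k, ∀ (X : (domSys (F.P K) M (k + 1)).Dom), ∀ φ ∈ sp K k X,
      ∃ (Ec : ℂ → ℂ) (O : Set ℂ) (Vc : ℂ), DifferentiableOn ℂ Ec O ∧ (∀ s ∈ Ioc (0 : ℝ) θ.γ, closedBall (s : ℂ) (c * s) ⊆ O) ∧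
        (∀ s ∈ Ioc (0 : ℝ) θ.γ, ∀ z ∈ closedBall (s : ℂ) (c * s), ‖Ec z - Vc‖ ≤ B'' * q ^ (k - (i : ℕ)) * Real.exp (-(κE * (domSys (F.P K) M (k + 1)).dj X)) * s ^ 2) ∧
        (∀ t ∈ Ioc (0 : ℝ) θ.γ, Ec t = ((S K) k).E (Function.update g i t) φ X))
    (h238 : ∀ K k, ((S K) k).Bound238 (box θ.γ k) (sp K k) A R) (hAn : ∀ K k, ((S K) k).AnalyticH (box θ.γ k) (sp K k))
    (Ec : ℕ → ℕ → Type*) [∀ K k, NormedAddCommGroup (Ec K k)] [∀ K k, NormedSpace ℂ (Ec K k)]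
    (ι : letI := θ.instVβ₁; letI := θ.instVβ₂
      (K k : ℕ) → (domSys (F.P K) M (k + 1)).Dom → ((Fin (F.P K).d → Site (F.P K) (k + 1) → θ.Vβ) →L[ℝ] Ec K k))
    (Φ : (K k : ℕ) → (domSys (F.P K) M (k + 1)).Dom → Ec K k → CPair (F.P K) 𝔸)
    (U : (K k : ℕ) → (domSys (F.P K) M (k + 1)).Dom → Set (Ec K k)) (hU : ∀ K k X, IsOpen (U K k X)) (hrU : ∀ K k X, ball (0 : Ec K k) r ⊆ U K k X)
    (hΦhol : ∀ (K k : ℕ) (X : (domSys (F.P K) M (k + 1)).Dom), DifferentiableOn ℂ (Φ K k X) (U K k X))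
    (hΦemb : letI := θ.instVβ₁; letI := θ.instVβ₂
      ∀ (K k : ℕ) (X : (domSys (F.P K) M (k + 1)).Dom) (Bf : Fin (F.P K).d → Site (F.P K) (k + 1) → θ.Vβ),
        Φ K k X (ι K k X Bf) = emb K k (fun l t => NormedSpace.exp (θ.ρ8 (Bf l t))))
    (hΦsp : ∀ (K k : ℕ) (X : (domSys (F.P K) M (k + 1)).Dom), ∀ z ∈ U K k X, ∀ Z : (domSys (F.P K) M (k + 1)).Dom, Z.1 ⊆ X.1 → Φ K k X z ∈ sp K k Z)
    (w : (K k : ℕ) → (domSys (F.P K) M (k + 1)).Dom → Site (F.P K) (k + 1) → ℝ) (hw₀ : ∀ K k X t, 0 ≤ w K k X t)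
    (hw : letI := θ.instVβ₁; letI := θ.instVβ₂; letI := θ.instιβ
      ∀ (K k : ℕ) (X : (domSys (F.P K) M (k + 1)).Dom) (l : Fin (F.P K).d) (t : Site (F.P K) (k + 1)) (cc : θ.ιβ),
        ‖ι K k X (Pi.single l (Pi.single t (θ.bV cc)))‖ ≤ w K k X t)
    (htail : ∀ (K k : ℕ) (X : (domSys (F.P K) M (k + 1)).Dom) (t : Site (F.P K) (k + 1)),
      let e : Site (F.P K) (k + 1) → TPt 4 (domCount (F.P K) M (k + 1) * M) := fun x i => (ZMod.cast (x i) : ZMod (domCount (F.P K) M (k + 1) * M))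
      w K k X t ≤ B₃ * Real.exp (-δ₀ * distCT (domCount (F.P K) M (k + 1)) M (e t) (nearT (M := M) (e t) X)))
    (lo : (k K : ℕ) → (domSys (F.P K) M (k + 1)).Dom → Prop) [∀ k K, DecidablePred (lo k K)]
    (hlo : ∀ (k K : ℕ) (X : (domSys (F.P K) M (k + 1)).Dom), ¬ lo k K X →
      let e : Site (F.P K) (k + 1) → TPt 4 (domCount (F.P K) M (k + 1) * M) := fun x i => (ZMod.cast (x i) : ZMod (domCount (F.P K) M (k + 1) * M))
      (K : ℝ) ≤ torusTreeLen X.1 ∨ (K : ℝ) ≤ distCT (domCount (F.P K) M (k + 1)) M (e (siteOfInt F K (k + 1) 0)) (nearT (M := M) (e (siteOfInt F K (k + 1) 0)) X))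
    (hr₀ : r₀ < 1) (hr₀' : 0 ≤ r₀) (hr₂ : 0 < r₂) (hr₂r : (2 * B₃ + 1) * r₂ ≤ r)
    (hG : letI := θ.instVβ₁; letI := θ.instVβ₂; letI := θ.instιβ
      ∀ g ∈ Window θ.γ, ∀ (k : ℕ) (μ ν : Fin 4) (z : Fin 4 → ℤ), ∃ (K₀ : ℕ) (C : ℝ), ∀ K : ℕ, K₀ ≤ K → ∀ (cc : θ.ιβ) (σ : Fin 2 → ℂ), ‖σ‖ < r₂ →
      ‖∑ X ∈ Finset.univ.filter (lo k (K + 1)), ((S (K + 1)) k).E (histPrefix g k) (Φ (K + 1) k X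
          (σ 0 • ι (K + 1) k X (Pi.single (Fin.cast (F.P_d (K + 1)).symm μ) (Pi.single (siteOfInt F (K + 1) (k + 1) z) (θ.bV cc))) +
           σ 1 • ι (K + 1) k X (Pi.single (Fin.cast (F.P_d (K + 1)).symm ν) (Pi.single (siteOfInt F (K + 1) (k + 1) 0) (θ.bV cc))))) X -
        ∑ X ∈ Finset.univ.filter (lo k K), ((S K) k).E (histPrefix g k) (Φ K k X
          (σ 0 • ι K k X (Pi.single (Fin.cast (F.P_d K).symm μ) (Pi.single (siteOfInt F K (k + 1) z) (θ.bV cc))) +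
           σ 1 • ι K k X (Pi.single (Fin.cast (F.P_d K).symm ν) (Pi.single (siteOfInt F K (k + 1) 0) (θ.bV cc))))) X‖ ≤ C * r₀ ^ K)
    (hκ₅ : delta1 δ₀ κ ((M : ℝ) * 4) ≤ κ₅) (hω : 0 < ℓ.ω) (hθω : ℓ.θ₅ * q ≤ ℓ.ω ^ 2) (hℓκ : ℓ.κ ≤ delta1 δ₀ κ ((M : ℝ) * 4))
    (hC₉ : (4 * (2 * C₅ / (1 - ℓ.θ₅) + 2 * ((16 * (Real.exp 1 * 9 * 64 * K₀ 64 8 ^ 2 * A) * B₃ ^ 2 / r ^ 2) * Real.exp (delta1 δ₀ κ ((M : ℝ) * 4) * ((M : ℝ) * 4) * 3) *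
        K₀ (4 * 2 ^ 4) (2 * 4) * K₁ 4 (δ₀ / 2))) / θ.γ +
        ((16 * ((6 * c ^ 2 + 32 * c + 64) / c ^ 2 * B'') * B₃ ^ 2 / r ^ 2) * Real.exp (delta1 δ₀ κ ((M : ℝ) * 4) * ((M : ℝ) * 4) * 3) * K₀ (4 * 2 ^ 4) (2 * 4) *
          K₁ 4 (δ₀ / 2)) * θ.γ / 2) / ℓ.ω ≤ ℓ.C₉) :
    NE9 ((objectsOfRecord₁₃ F N θ ℓ).EA 0) (Window θ.γ) ℓ.κ ℓ.moduli :=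
  ne9_EA_objectsOfRecord₁₃_of_kernelStepRate_sectorHoloGrowing_printedValue F N θ ℓ hs hγ
    (polLimitsExistOfRecord₁₃_of_twoPointGenerating F N θ m' hM S emb hloc (fun _ k => box θ.γ k) (fun _ hg _ k => histPrefix_mem_box hg k) sp
      hA hr₁ hκ0 (hκE.trans hκEr) hκ4 hrate hsmall hB₃ hδ₀ hr h238 Ec ι Φ U hU hrU
      (fun K k _ hh X Z hZ => differentiableOn_H_comp_of_analyticH ((S K) k) (box θ.γ k) (sp K k) (hAn K k) hh (Φ K k X) (hΦhol K k X) X (hΦsp K k X) Z hZ)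
      hΦemb hΦsp w hw₀ hw htail lo hlo hr₀ hr₀' hr₂ hr₂r hG)
    hC₅ h5 m' M hM S emb hloc sp hc hB'' hq hA hr₁ hrate hsmall (by linarith) hδ₀ hB₃ hr hκE hκEr hLsec h238 hAn Ec ι Φ U hU hrU hΦhol hΦemb hΦsp
    w hw₀ hw htail hκ₅ hω hθω hℓκ hC₉

/-! ## §2 The REAL `C^{1,1}` edition at the reading's image tables: (1.18) and term holomorphy both from print's slots -/

open Classical in
/-- ★★★ **K3's `h9` — AGE-WEIGHTED REAL `C^{1,1}` EDITION WITH (1.18) DERIVED.**  J49 §2 `ne9_EA_objectsOfRecord₁₃_of_kernelStepRate_termSecondDiffGrowing_outputBound` at the image tables `X ↦ Φ K k X '' U K k X`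
with `hΔ` PRODUCED by p641315 §0 `norm_secondDiff_le_of_derivLipschitz` from the REAL datum `hC11` (derivative Lipschitz with constant `L·q^{k−i}·e^{−κ_E d}`) on the ORIGINAL tables (`M₂ := L`), `hbd` := §0, `hEhol` := p621851 §0, ball clause
:= `ball 0 r ⊆ U`.  Inputs: as in §1 with `hC11` (letter `L ≥ 0`) in place of the sector datum ⟹ `NE9 ((objectsOfRecord₁₃ F N θ ℓ).EA 0) (Window θ.γ) ℓ.κ ℓ.moduli`.  NO (1.18)
bound, NO holomorphy in the coupling, NO term-holomorphy binder displayed.  LOCATED (hypothesis form); N22 NOT discharged. -/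
theorem ne9_EA_objectsOfRecord₁₃_of_kernelStepRate_derivLipschitzGrowing_printedValue (θ : Stage13Params F N) (ℓ : U3Letters₁₁) (hs : ℓ.Signs) (hγ : 0 < θ.γ)
    (hlim : PolLimitsExistOfRecord₁₃ F N θ) {κ₅ C₅ : ℝ} (hC₅ : 0 ≤ C₅) (h5 : KernelStepRateOfRecord₁₃ F N θ κ₅ ℓ.θ₅ C₅)
    {𝔸 : Type*} [NormedRing 𝔸] [NormedAlgebra ℂ 𝔸] (m' : ℕ) (M : ℕ) [NeZero M] (hM : M = F.L ^ m')
    (S : (K : ℕ) → ClusterTower (F.P K) 𝔸 M) (emb : ReadingMaps F (MatA N) 𝔸) (hloc : Localizes17OfRecord₁₃ F N θ S emb)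
    (sp : (K k : ℕ) → (domSys (F.P K) M (k + 1)).Dom → Set (CPair (F.P K) 𝔸))
    {κ κE δ₀ B₃ r L q A R r₁ : ℝ} (hL : 0 ≤ L) (hq : 1 ≤ q)
    (hA : 0 ≤ A) (hr₁ : 0 ≤ r₁) (hrate : r₁ + 2 * (64 * Real.log 162) + 2 ≤ R) (hsmall : A * Real.exp (5 * r₁ + 1) * K₀ 64 8 * 9 * 64 ≤ 1)
    (hκ₀ : kappa₀ (4 * 2 ^ 4) (2 * 4) ≤ κ / 2) (hδ₀ : 0 < δ₀) (hB₃ : 0 ≤ B₃) (hr : 0 < r) (hκE : κ ≤ κE) (hκEr : κE ≤ r₁)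
    (hC11 : ∀ (K k : ℕ) (i : Fin (k + 1)), ∀ g ∈ box θ.γ k, ∀ (X : (domSys (F.P K) M (k + 1)).Dom), ∀ φ ∈ sp K k X,
      ∃ fd : ℝ → ℂ, (∀ t ∈ Ioc (0 : ℝ) θ.γ, HasDerivAt (fun s : ℝ => ((S K) k).E (Function.update g i s) φ X) (fd t) t) ∧
        (∀ t ∈ Ioc (0 : ℝ) θ.γ, ∀ t' ∈ Ioc (0 : ℝ) θ.γ, ‖fd t - fd t'‖ ≤ L * q ^ (k - (i : ℕ)) * Real.exp (-(κE * (domSys (F.P K) M (k + 1)).dj X)) * |t - t'|))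
    (h238 : ∀ K k, ((S K) k).Bound238 (box θ.γ k) (sp K k) A R) (hAn : ∀ K k, ((S K) k).AnalyticH (box θ.γ k) (sp K k))
    (Ec : ℕ → ℕ → Type*) [∀ K k, NormedAddCommGroup (Ec K k)] [∀ K k, NormedSpace ℂ (Ec K k)]
    (ι : letI := θ.instVβ₁; letI := θ.instVβ₂
      (K k : ℕ) → (domSys (F.P K) M (k + 1)).Dom → ((Fin (F.P K).d → Site (F.P K) (k + 1) → θ.Vβ) →L[ℝ] Ec K k))
    (Φ : (K k : ℕ) → (domSys (F.P K) M (k + 1)).Dom → Ec K k → CPair (F.P K) 𝔸)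
    (U : (K k : ℕ) → (domSys (F.P K) M (k + 1)).Dom → Set (Ec K k)) (hU : ∀ K k X, IsOpen (U K k X)) (hrU : ∀ K k X, ball (0 : Ec K k) r ⊆ U K k X)
    (hΦhol : ∀ (K k : ℕ) (X : (domSys (F.P K) M (k + 1)).Dom), DifferentiableOn ℂ (Φ K k X) (U K k X))
    (hΦemb : letI := θ.instVβ₁; letI := θ.instVβ₂
      ∀ (K k : ℕ) (X : (domSys (F.P K) M (k + 1)).Dom) (Bf : Fin (F.P K).d → Site (F.P K) (k + 1) → θ.Vβ),
        Φ K k X (ι K k X Bf) = emb K k (fun l t => NormedSpace.exp (θ.ρ8 (Bf l t))))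
    (hΦsp : ∀ (K k : ℕ) (X : (domSys (F.P K) M (k + 1)).Dom), ∀ z ∈ U K k X, ∀ Z : (domSys (F.P K) M (k + 1)).Dom, Z.1 ⊆ X.1 → Φ K k X z ∈ sp K k Z)
    (w : (K k : ℕ) → (domSys (F.P K) M (k + 1)).Dom → Site (F.P K) (k + 1) → ℝ) (hw₀ : ∀ K k X t, 0 ≤ w K k X t)
    (hw : letI := θ.instVβ₁; letI := θ.instVβ₂; letI := θ.instιβ
      ∀ (K k : ℕ) (X : (domSys (F.P K) M (k + 1)).Dom) (l : Fin (F.P K).d) (t : Site (F.P K) (k + 1)) (cc : θ.ιβ),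
        ‖ι K k X (Pi.single l (Pi.single t (θ.bV cc)))‖ ≤ w K k X t)
    (htail : ∀ (K k : ℕ) (X : (domSys (F.P K) M (k + 1)).Dom) (t : Site (F.P K) (k + 1)),
      let e : Site (F.P K) (k + 1) → TPt 4 (domCount (F.P K) M (k + 1) * M) := fun x i => (ZMod.cast (x i) : ZMod (domCount (F.P K) M (k + 1) * M))
      w K k X t ≤ B₃ * Real.exp (-δ₀ * distCT (domCount (F.P K) M (k + 1)) M (e t) (nearT (M := M) (e t) X)))
    (hκ₅ : delta1 δ₀ κ ((M : ℝ) * 4) ≤ κ₅) (hω : 0 < ℓ.ω) (hθω : ℓ.θ₅ * q ≤ ℓ.ω ^ 2) (hℓκ : ℓ.κ ≤ delta1 δ₀ κ ((M : ℝ) * 4))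
    (hC₉ : (4 * (2 * C₅ / (1 - ℓ.θ₅) + 2 * ((16 * (Real.exp 1 * 9 * 64 * K₀ 64 8 ^ 2 * A) * B₃ ^ 2 / r ^ 2) * Real.exp (delta1 δ₀ κ ((M : ℝ) * 4) * ((M : ℝ) * 4) * 3) *
        K₀ (4 * 2 ^ 4) (2 * 4) * K₁ 4 (δ₀ / 2))) / θ.γ +
        ((16 * L * B₃ ^ 2 / r ^ 2) * Real.exp (delta1 δ₀ κ ((M : ℝ) * 4) * ((M : ℝ) * 4) * 3) * K₀ (4 * 2 ^ 4) (2 * 4) *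
          K₁ 4 (δ₀ / 2)) * θ.γ / 2) / ℓ.ω ≤ ℓ.C₉) :
    NE9 ((objectsOfRecord₁₃ F N θ ℓ).EA 0) (Window θ.γ) ℓ.κ ℓ.moduli := by
  -- the age-weighted term-level second-difference letter ON THE IMAGE TABLES from the REAL `C^{1,1}` datum on the original tables (p641315 §0)
  have hΔ : ∀ (K k : ℕ) (i : Fin (k + 1)), ∀ g ∈ box θ.γ k, ∀ (X : (domSys (F.P K) M (k + 1)).Dom), ∀ φ ∈ Φ K k X '' U K k X, ∀ t d : ℝ, 0 < d →
      t - d ∈ Ioc (0 : ℝ) θ.γ → t + d ∈ Ioc (0 : ℝ) θ.γ →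
        ‖((S K) k).E (Function.update g i (t + d)) φ X - 2 * ((S K) k).E (Function.update g i t) φ X + ((S K) k).E (Function.update g i (t - d)) φ X‖ ≤
          L * q ^ (k - (i : ℕ)) * Real.exp (-(κE * (domSys (F.P K) M (k + 1)).dj X)) * d ^ 2 := by
    intro K k i g hg X φ hφ t d hd hm hp
    obtain ⟨z, hz, rfl⟩ := hφ
    obtain ⟨fd, hfd, hfL⟩ := hC11 K k i g hg X _ (hΦsp K k X z hz X subset_rfl)
    have hsub : ∀ x ∈ Icc (t - d) (t + d), x ∈ Ioc (0 : ℝ) θ.γ := fun x hx => ⟨lt_of_lt_of_le hm.1 hx.1, hx.2.trans hp.2⟩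
    exact norm_secondDiff_le_of_derivLipschitz (f := fun s : ℝ => ((S K) k).E (Function.update g i s) (Φ K k X z) X) hd (fun x hx => hfd x (hsub x hx))
      (fun x hx y hy => hfL x (hsub x hx) y (hsub y hy))
  exact ne9_EA_objectsOfRecord₁₃_of_kernelStepRate_termSecondDiffGrowing_outputBound F N θ ℓ hs hγ hlim hC₅ h5 m' M hM S emb hloc (fun K k X => Φ K k X '' U K k X) hκ₀ hδ₀
    hB₃ hr hL hq (by positivity) hκE hΔ (outputBound_readingImage_of_printedSlots F S sp hA hr₁ hrate hsmall hκEr h238 hAn Ec Φ U hU hΦhol hΦsp) Ec ι Φ U hU hrU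
    (differentiableOn_E_comp_of_printedSlots F S sp hA hr₁ hrate hsmall h238 hAn Ec Φ U hU hΦhol hΦsp) hΦemb (fun K k X z hz => mem_image_of_mem _ (hrU K k X hz))
    w hw₀ hw htail hκ₅ hω hθω hℓκ hC₉

open Classical in
/-- ★★★ **K3's `h9` — AGE-WEIGHTED REAL `C^{1,1}` EDITION WITH (1.18) DERIVED AND (1.21) BY (G≈).**  §2 with `hlim := polLimitsExistOfRecord₁₃_of_twoPointGenerating …` (p616912 §3).  NO (1.18) bound,
NO holomorphy in the coupling, NO term-holomorphy binder, NO (1.21) letter displayed.  LOCATED (hypothesis form); N22 NOT discharged. -/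
theorem ne9_EA_objectsOfRecord₁₃_of_kernelStepRate_derivLipschitzGrowing_printedValue_twoPointGenerating (θ : Stage13Params F N) (ℓ : U3Letters₁₁) (hs : ℓ.Signs)
    (hγ : 0 < θ.γ) {κ₅ C₅ : ℝ} (hC₅ : 0 ≤ C₅) (h5 : KernelStepRateOfRecord₁₃ F N θ κ₅ ℓ.θ₅ C₅)
    {𝔸 : Type*} [NormedRing 𝔸] [NormedAlgebra ℂ 𝔸] (m' : ℕ) (M : ℕ) [NeZero M] (hM : M = F.L ^ m')
    (S : (K : ℕ) → ClusterTower (F.P K) 𝔸 M) (emb : ReadingMaps F (MatA N) 𝔸) (hloc : Localizes17OfRecord₁₃ F N θ S emb)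
    (sp : (K k : ℕ) → (domSys (F.P K) M (k + 1)).Dom → Set (CPair (F.P K) 𝔸))
    {κ κE δ₀ B₃ r L q A R r₁ r₂ r₀ : ℝ} (hL : 0 ≤ L) (hq : 1 ≤ q)
    (hA : 0 ≤ A) (hr₁ : 0 ≤ r₁) (hrate : r₁ + 2 * (64 * Real.log 162) + 2 ≤ R) (hsmall : A * Real.exp (5 * r₁ + 1) * K₀ 64 8 * 9 * 64 ≤ 1)
    (hκ0 : 0 < κ) (hκ4 : kappa₀ (4 * 2 ^ 4) (2 * 4) ≤ κ / 2 / 2) (hδ₀ : 0 < δ₀) (hB₃ : 0 ≤ B₃) (hr : 0 < r) (hκE : κ ≤ κE) (hκEr : κE ≤ r₁)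
    (hC11 : ∀ (K k : ℕ) (i : Fin (k + 1)), ∀ g ∈ box θ.γ k, ∀ (X : (domSys (F.P K) M (k + 1)).Dom), ∀ φ ∈ sp K k X,
      ∃ fd : ℝ → ℂ, (∀ t ∈ Ioc (0 : ℝ) θ.γ, HasDerivAt (fun s : ℝ => ((S K) k).E (Function.update g i s) φ X) (fd t) t) ∧
        (∀ t ∈ Ioc (0 : ℝ) θ.γ, ∀ t' ∈ Ioc (0 : ℝ) θ.γ, ‖fd t - fd t'‖ ≤ L * q ^ (k - (i : ℕ)) * Real.exp (-(κE * (domSys (F.P K) M (k + 1)).dj X)) * |t - t'|))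
    (h238 : ∀ K k, ((S K) k).Bound238 (box θ.γ k) (sp K k) A R) (hAn : ∀ K k, ((S K) k).AnalyticH (box θ.γ k) (sp K k))
    (Ec : ℕ → ℕ → Type*) [∀ K k, NormedAddCommGroup (Ec K k)] [∀ K k, NormedSpace ℂ (Ec K k)]
    (ι : letI := θ.instVβ₁; letI := θ.instVβ₂
      (K k : ℕ) → (domSys (F.P K) M (k + 1)).Dom → ((Fin (F.P K).d → Site (F.P K) (k + 1) → θ.Vβ) →L[ℝ] Ec K k))
    (Φ : (K k : ℕ) → (domSys (F.P K) M (k + 1)).Dom → Ec K k → CPair (F.P K) 𝔸)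
    (U : (K k : ℕ) → (domSys (F.P K) M (k + 1)).Dom → Set (Ec K k)) (hU : ∀ K k X, IsOpen (U K k X)) (hrU : ∀ K k X, ball (0 : Ec K k) r ⊆ U K k X)
    (hΦhol : ∀ (K k : ℕ) (X : (domSys (F.P K) M (k + 1)).Dom), DifferentiableOn ℂ (Φ K k X) (U K k X))
    (hΦemb : letI := θ.instVβ₁; letI := θ.instVβ₂
      ∀ (K k : ℕ) (X : (domSys (F.P K) M (k + 1)).Dom) (Bf : Fin (F.P K).d → Site (F.P K) (k + 1) → θ.Vβ),
        Φ K k X (ι K k X Bf) = emb K k (fun l t => NormedSpace.exp (θ.ρ8 (Bf l t))))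
    (hΦsp : ∀ (K k : ℕ) (X : (domSys (F.P K) M (k + 1)).Dom), ∀ z ∈ U K k X, ∀ Z : (domSys (F.P K) M (k + 1)).Dom, Z.1 ⊆ X.1 → Φ K k X z ∈ sp K k Z)
    (w : (K k : ℕ) → (domSys (F.P K) M (k + 1)).Dom → Site (F.P K) (k + 1) → ℝ) (hw₀ : ∀ K k X t, 0 ≤ w K k X t)
    (hw : letI := θ.instVβ₁; letI := θ.instVβ₂; letI := θ.instιβ
      ∀ (K k : ℕ) (X : (domSys (F.P K) M (k + 1)).Dom) (l : Fin (F.P K).d) (t : Site (F.P K) (k + 1)) (cc : θ.ιβ),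
        ‖ι K k X (Pi.single l (Pi.single t (θ.bV cc)))‖ ≤ w K k X t)
    (htail : ∀ (K k : ℕ) (X : (domSys (F.P K) M (k + 1)).Dom) (t : Site (F.P K) (k + 1)),
      let e : Site (F.P K) (k + 1) → TPt 4 (domCount (F.P K) M (k + 1) * M) := fun x i => (ZMod.cast (x i) : ZMod (domCount (F.P K) M (k + 1) * M))
      w K k X t ≤ B₃ * Real.exp (-δ₀ * distCT (domCount (F.P K) M (k + 1)) M (e t) (nearT (M := M) (e t) X)))
    (lo : (k K : ℕ) → (domSys (F.P K) M (k + 1)).Dom → Prop) [∀ k K, DecidablePred (lo k K)]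
    (hlo : ∀ (k K : ℕ) (X : (domSys (F.P K) M (k + 1)).Dom), ¬ lo k K X →
      let e : Site (F.P K) (k + 1) → TPt 4 (domCount (F.P K) M (k + 1) * M) := fun x i => (ZMod.cast (x i) : ZMod (domCount (F.P K) M (k + 1) * M))
      (K : ℝ) ≤ torusTreeLen X.1 ∨ (K : ℝ) ≤ distCT (domCount (F.P K) M (k + 1)) M (e (siteOfInt F K (k + 1) 0)) (nearT (M := M) (e (siteOfInt F K (k + 1) 0)) X))
    (hr₀ : r₀ < 1) (hr₀' : 0 ≤ r₀) (hr₂ : 0 < r₂) (hr₂r : (2 * B₃ + 1) * r₂ ≤ r)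
    (hG : letI := θ.instVβ₁; letI := θ.instVβ₂; letI := θ.instιβ
      ∀ g ∈ Window θ.γ, ∀ (k : ℕ) (μ ν : Fin 4) (z : Fin 4 → ℤ), ∃ (K₀ : ℕ) (C : ℝ), ∀ K : ℕ, K₀ ≤ K → ∀ (cc : θ.ιβ) (σ : Fin 2 → ℂ), ‖σ‖ < r₂ →
      ‖∑ X ∈ Finset.univ.filter (lo k (K + 1)), ((S (K + 1)) k).E (histPrefix g k) (Φ (K + 1) k X
          (σ 0 • ι (K + 1) k X (Pi.single (Fin.cast (F.P_d (K + 1)).symm μ) (Pi.single (siteOfInt F (K + 1) (k + 1) z) (θ.bV cc))) +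
           σ 1 • ι (K + 1) k X (Pi.single (Fin.cast (F.P_d (K + 1)).symm ν) (Pi.single (siteOfInt F (K + 1) (k + 1) 0) (θ.bV cc))))) X -
        ∑ X ∈ Finset.univ.filter (lo k K), ((S K) k).E (histPrefix g k) (Φ K k X
          (σ 0 • ι K k X (Pi.single (Fin.cast (F.P_d K).symm μ) (Pi.single (siteOfInt F K (k + 1) z) (θ.bV cc))) +
           σ 1 • ι K k X (Pi.single (Fin.cast (F.P_d K).symm ν) (Pi.single (siteOfInt F K (k + 1) 0) (θ.bV cc))))) X‖ ≤ C * r₀ ^ K)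
    (hκ₅ : delta1 δ₀ κ ((M : ℝ) * 4) ≤ κ₅) (hω : 0 < ℓ.ω) (hθω : ℓ.θ₅ * q ≤ ℓ.ω ^ 2) (hℓκ : ℓ.κ ≤ delta1 δ₀ κ ((M : ℝ) * 4))
    (hC₉ : (4 * (2 * C₅ / (1 - ℓ.θ₅) + 2 * ((16 * (Real.exp 1 * 9 * 64 * K₀ 64 8 ^ 2 * A) * B₃ ^ 2 / r ^ 2) * Real.exp (delta1 δ₀ κ ((M : ℝ) * 4) * ((M : ℝ) * 4) * 3) *
        K₀ (4 * 2 ^ 4) (2 * 4) * K₁ 4 (δ₀ / 2))) / θ.γ +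
        ((16 * L * B₃ ^ 2 / r ^ 2) * Real.exp (delta1 δ₀ κ ((M : ℝ) * 4) * ((M : ℝ) * 4) * 3) * K₀ (4 * 2 ^ 4) (2 * 4) *
          K₁ 4 (δ₀ / 2)) * θ.γ / 2) / ℓ.ω ≤ ℓ.C₉) :
    NE9 ((objectsOfRecord₁₃ F N θ ℓ).EA 0) (Window θ.γ) ℓ.κ ℓ.moduli :=
  ne9_EA_objectsOfRecord₁₃_of_kernelStepRate_derivLipschitzGrowing_printedValue F N θ ℓ hs hγ
    (polLimitsExistOfRecord₁₃_of_twoPointGenerating F N θ m' hM S emb hloc (fun _ k => box θ.γ k) (fun _ hg _ k => histPrefix_mem_box hg k) sp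
      hA hr₁ hκ0 (hκE.trans hκEr) hκ4 hrate hsmall hB₃ hδ₀ hr h238 Ec ι Φ U hU hrU
      (fun K k _ hh X Z hZ => differentiableOn_H_comp_of_analyticH ((S K) k) (box θ.γ k) (sp K k) (hAn K k) hh (Φ K k X) (hΦhol K k X) X (hΦsp K k X) Z hZ)
      hΦemb hΦsp w hw₀ hw htail lo hlo hr₀ hr₀' hr₂ hr₂r hG)
    hC₅ h5 m' M hM S emb hloc sp hL hq hA hr₁ hrate hsmall (by linarith) hδ₀ hB₃ hr hκE hκEr hC11 h238 hAn Ec ι Φ U hU hrU hΦhol hΦemb hΦsp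
    w hw₀ hw htail hκ₅ hω hθω hℓκ hC₉

end YMDAG.N22.AtRecordOfPrintedSlots

end
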